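/-
  HodgeLocusCensusUnitColumnRankLevelsCriterion.lean — pub-hlocus ENGINE B (ivhs-2, gen 55), PROBE 17 (successor material; probe-only, NOT filed).
  certified instances and evidence bearing on the general Hodge conjecture; no claim.

  KERNEL RANK THEOREMS (evidence class; no census number changes; nothing about HC). THE EXCEPTION CRITERION FOR THE UNIT COLUMN OF ×q^c
  (`rank_charP_eq_rank_charZero_iff`): for a prime p > c ≥ 1, a field K of characteristic p and a field K₀ of characteristic 0, anchor 229's
  multiplicity matrix of ×q^c on K[x₁,…,x_k]/(xᵢ^{e+2}) at level j (VERBATIM) has the SAME rank over K as over K₀ (THEOREM L's value) iff every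
  feasible label μ (e+1 ∣ j + Σμ, (e+1)s ≤ j + Σμ; s = #{μ ≠ 0}, t = (j + Σμ)/(e+1) − s, m = k − s) has an empty block (m < t + c) or satisfies
      min (t, m − t − c) + c < p;
  equivalently the p-rank DROPS iff some non-empty feasible block has min (t, m − t − c) + c ≥ p. COROLLARY (`rank_charP_eq_rank_charZero_of_lt`):
  no drop whenever k + c < 2p (sharper than PROBE 12's p > k). MECHANISM: PROBE 16b writes both ranks as the same double sum whose (μ-)terms are
  Wilson sums Σ_{i ≤ T} [p ∤ C(T+c−i, T−i)] (C(m,i) − C(m,i−1)) with T = t (Wilson range) or T = m − t − c (complement range); every summand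
  C(m,i) − C(m,i−1) is POSITIVE for 2i ≤ m (`choose_pred_lt_choose`), so the characteristic-p sum equals the characteristic-0 sum iff no test
  fires (`wilson_sum_eq_iff`, `wilson_sum_prime_eq_zero_iff`), and by KUMMER (`prime_dvd_choose_add_iff`: for p > c, p ∣ C(u+c, u) iff
  u mod p ≥ p − c; least such u is p − c, `exists_dvd_choose_add_iff`) a test fires iff T + c ≥ p. Termwise comparison: `blockval_le`, `blockval_eq_iff`,
  `Finset.sum_eq_sum_iff_of_le`. SHARPNESS (`rank_charP_lt_rank_charZero`): for 1 ≤ c < p prime and 2p ≤ k + c the rank DROPS at level j = (e+1)(p − c)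
  (zero label, block c!·W_{p−c,p} on all k coordinates), so the exceptional primes p > c of ×q^c on k variables are exactly those with 2p ≤ k + c, in
  every degree e; `rank_charP_le_rank_charZero`: rank_K ≤ rank_{K₀} always (p > c); `exists_rank_charP_lt_iff`: (∃ level with a drop) ↔ 2p ≤ k + c.
  14 theorems, 0 defs; imports PROBE 16b `…HodgeLocusCensusUnitColumnRankLevelsWilson` by name (hence 16a, anchors 229/230); nothing restated but
  anchor 229's matrix and anchor 230's feasibility condition (VERBATIM, as in 16b); no sorries, axioms, instances or notation.
-/
import Summits.HodgeConjecture.HodgeConjecture.Theorems.HodgeLocusCensusUnitColumnRankLevelsWilson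

set_option linter.dupNamespace false
set_option autoImplicit false

namespace Summit.HodgeConjecture.HodgeConjecture.HodgeLocus.Census.UnitColumnRankLevelsCriterion

open Summit.HodgeConjecture.HodgeConjecture.HodgeLocus.Census.ModelNonJumpC1All (colR)
open Summit.HodgeConjecture.HodgeConjecture.HodgeLocus.Census.InclusionRankComplement (cast_factorial_ne_zero)
open Summit.HodgeConjecture.HodgeConjecture.HodgeLocus.Census.UnitColumnRankLevelsWilson (rank_mulDeltaPow_levels_eq_sum_wilson)

/-! ## §1 Kummer's carry criterion for `C(u + c, u)` modulo a prime `p > c` -/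

/-- (K1) for a prime `p > c`: `p ∣ C(u+c, u)` iff adding `c` to `u` carries in base `p`, i.e. iff `u mod p ≥ p − c`. -/
theorem prime_dvd_choose_add_iff {p c : ℕ} (hp : p.Prime) (hcp : c < p) (u : ℕ) :
    p ∣ (u + c).choose u ↔ p ≤ u % p + c := by
  haveI := Fact.mk hp
  have hluc := Choose.choose_modEq_choose_mod_mul_choose_div_nat (n := u + c) (k := u) (p := p)
  have key : p ∣ (u + c).choose u ↔ p ∣ ((u + c) % p).choose (u % p) * ((u + c) / p).choose (u / p) :=
    hluc.dvd_iff dvd_rfl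
  rw [key]
  have hup : u % p < p := Nat.mod_lt u hp.pos
  by_cases h : p ≤ u % p + c
  · have h1 : (u + c) % p = u % p + c - p := by
      rw [Nat.add_mod, Nat.mod_eq_of_lt hcp, Nat.mod_eq_sub_mod h, Nat.mod_eq_of_lt (by omega)]
    have h2 : ((u + c) % p).choose (u % p) = 0 := Nat.choose_eq_zero_of_lt (by omega)
    rw [h2, zero_mul]
    exact iff_of_true (dvd_zero p) h
  · have h1 : (u + c) % p = u % p + c := by
      rw [Nat.add_mod, Nat.mod_eq_of_lt hcp, Nat.mod_eq_of_lt (by omega)]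
    have h2 : (u + c) / p = u / p := by
      rw [Nat.add_div hp.pos, Nat.div_eq_of_lt hcp, Nat.mod_eq_of_lt hcp, if_neg h, add_zero, add_zero]
    rw [h1, h2, Nat.choose_self, mul_one]
    refine iff_of_false (fun hd => ?_) h
    have hcop := Nat.Prime.coprime_choose_of_lt hp (b := u % p + c) (a := u % p) (by omega) (by omega)
    exact hp.one_lt.ne' (Nat.Coprime.eq_one_of_dvd hcop hd)

/-- (K2) for a prime `p > c > 0`: some `u ≤ T` has `p ∣ C(u+c, u)` iff `T + c ≥ p` (the least carrying `u` is `p − c`).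
(For `c = 0` every `C(u, u) = 1`: no prime divides.) -/
theorem exists_dvd_choose_add_iff {p c : ℕ} (hp : p.Prime) (hc : 0 < c) (hcp : c < p) (T : ℕ) :
    (∃ u, u ≤ T ∧ p ∣ (u + c).choose u) ↔ p ≤ T + c := by
  constructor
  · rintro ⟨u, huT, hu⟩
    rw [prime_dvd_choose_add_iff hp hcp] at hu
    have := Nat.mod_le u p
    omega
  · intro h
    refine ⟨p - c, by omega, ?_⟩
    rw [prime_dvd_choose_add_iff hp hcp, Nat.mod_eq_of_lt (by omega)]
    omega

/-! ## §2 the truncated telescoping sums of Wilson's formula at `n = t + c` -/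

/-- (W1) dropping terms: the Wilson sum with divisibility test `P` is at most the one with test `Q` whenever `Q j → P j`. -/
theorem wilson_sum_le_of_imp (m T : ℕ) (P Q : ℕ → Prop) [DecidablePred P] [DecidablePred Q] (hPQ : ∀ j, Q j → P j) :
    (∑ j ∈ Finset.range (T + 1), if P j then 0 else (m.choose j - if j = 0 then 0 else m.choose (j - 1))) ≤
      ∑ j ∈ Finset.range (T + 1), if Q j then 0 else (m.choose j - if j = 0 then 0 else m.choose (j - 1)) := by
  refine Finset.sum_le_sum (fun j _ => ?_)
  by_cases hQ : Q j
  · rw [if_pos (hPQ j hQ), if_pos hQ]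
  · rw [if_neg hQ]
    split_ifs <;> omega

/-- strict growth of `C(m, ·)` on the first half: `C(m, j−1) < C(m, j)` for `1 ≤ j`, `2j ≤ m`. -/
theorem choose_pred_lt_choose (m j : ℕ) (hj : 1 ≤ j) (hjm : 2 * j ≤ m) : m.choose (j - 1) < m.choose j := by
  obtain ⟨i, rfl⟩ : ∃ i, j = i + 1 := ⟨j - 1, by omega⟩
  rw [Nat.add_sub_cancel]
  have h := Nat.choose_succ_right_eq m i
  have hpos : 0 < m.choose i := Nat.choose_pos (by omega)
  by_contra hle
  rw [not_lt] at hle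
  have : m.choose (i + 1) * (i + 1) ≤ m.choose i * (i + 1) := Nat.mul_le_mul_right _ hle
  rw [h] at this
  have := Nat.le_of_mul_le_mul_left this hpos
  omega

/-- (W2) with all terms positive (`2T ≤ m`), the sums with tests `P ⊇ Q` agree iff `P` and `Q` agree on `j ≤ T`. -/
theorem wilson_sum_eq_iff (m T : ℕ) (hTm : 2 * T ≤ m) (P Q : ℕ → Prop) [DecidablePred P] [DecidablePred Q]
    (hPQ : ∀ j, Q j → P j) :
    (∑ j ∈ Finset.range (T + 1), if P j then 0 else (m.choose j - if j = 0 then 0 else m.choose (j - 1))) =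
      ∑ j ∈ Finset.range (T + 1), (if Q j then 0 else (m.choose j - if j = 0 then 0 else m.choose (j - 1))) ↔
      ∀ j, j ≤ T → P j → Q j := by
  rw [Finset.sum_eq_sum_iff_of_le (fun j _ => ?_)]
  · constructor
    · intro h j hj hP
      by_contra hQ
      have hj' : j ∈ Finset.range (T + 1) := Finset.mem_range.mpr (by omega)
      have := h j hj'
      rw [if_pos hP, if_neg hQ] at this
      have hpos : 0 < m.choose j - if j = 0 then 0 else m.choose (j - 1) := by
        split_ifs with h0
        · rw [h0, Nat.choose_zero_right]; norm_num
        · have := choose_pred_lt_choose m j (by omega) (by omega); omega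
      omega
    · intro h j hj
      have hj' : j ≤ T := by rw [Finset.mem_range] at hj; omega
      by_cases hQ : Q j
      · rw [if_pos (hPQ j hQ), if_pos hQ]
      · rw [if_neg hQ, if_neg (fun hP => hQ (h j hj' hP))]
  · by_cases hQ : Q j
    · rw [if_pos (hPQ j hQ), if_pos hQ]
    · rw [if_neg hQ]
      split_ifs <;> omega

/-- (W3) THE BLOCK CRITERION: for a prime `p > c > 0` and `2T ≤ m`, Wilson's sum with test `p ∣ C(T+c−j, T−j)` equals the full telescoping
sum (test `0 ∣ C(T+c−j, T−j)`, i.e. `C = 0`, never true) iff `T + c < p`. -/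
theorem wilson_sum_prime_eq_zero_iff {p c : ℕ} (hp : p.Prime) (hc : 0 < c) (hcp : c < p) (m T N : ℕ) (hN : N = T + c)
    (hTm : 2 * T ≤ m) :
    (∑ j ∈ Finset.range (T + 1), if p ∣ (N - j).choose (T - j) then 0 else (m.choose j - if j = 0 then 0 else m.choose (j - 1))) =
      ∑ j ∈ Finset.range (T + 1), (if 0 ∣ (N - j).choose (T - j) then 0 else (m.choose j - if j = 0 then 0 else m.choose (j - 1))) ↔
      T + c < p := by
  subst hN
  rw [wilson_sum_eq_iff m T hTm _ _ (fun j h => by rw [zero_dvd_iff] at h; rw [h]; exact dvd_zero p)]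
  constructor
  · intro h
    by_contra hle
    rw [not_lt] at hle
    obtain ⟨u, huT, hu⟩ := (exists_dvd_choose_add_iff hp hc hcp T).mpr hle
    have h' := h (T - u) (by omega) (by rwa [show T + c - (T - u) = u + c by omega, show T - (T - u) = u by omega])
    rw [zero_dvd_iff] at h'
    exact (Nat.choose_pos (by omega)).ne' h'
  · intro h j hj hd
    exfalso
    rw [show T + c - j = (T - j) + c by omega] at hd
    have := (prime_dvd_choose_add_iff hp hcp (T - j)).mp hd
    have := Nat.mod_le (T - j) p
    omega

/-- (W1′) the same comparison as an inequality, for every `p` (no hypotheses). -/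
theorem wilson_sum_prime_le_zero (p m T N : ℕ) :
    (∑ j ∈ Finset.range (T + 1), if p ∣ (N - j).choose (T - j) then 0 else (m.choose j - if j = 0 then 0 else m.choose (j - 1))) ≤
      ∑ j ∈ Finset.range (T + 1), (if 0 ∣ (N - j).choose (T - j) then 0 else (m.choose j - if j = 0 then 0 else m.choose (j - 1))) :=
  wilson_sum_le_of_imp m T _ _ (fun j h => by rw [zero_dvd_iff] at h; rw [h]; exact dvd_zero p)

/-! ## §3 the block values of PROBE 16b compared between characteristic `p` and characteristic `0` -/

/-- (B≤) every block value in characteristic `p` is at most its characteristic-`0` value (terms are only dropped). -/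
theorem blockval_le (p m t c : ℕ) (P : Prop) [Decidable P] :
    (if P then
        (if m < t + c then 0
         else if t + (t + c) ≤ m then
           ∑ i ∈ Finset.range (t + 1),
             if p ∣ (t + c - i).choose (t - i) then 0 else (m.choose i - if i = 0 then 0 else m.choose (i - 1))
         else
           ∑ i ∈ Finset.range (m - (t + c) + 1),
             if p ∣ (m - t - i).choose (m - (t + c) - i) then 0 else (m.choose i - if i = 0 then 0 else m.choose (i - 1)))
      else 0) ≤
      (if P then
        (if m < t + c then 0
         else if t + (t + c) ≤ m then
           ∑ i ∈ Finset.range (t + 1),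
             if 0 ∣ (t + c - i).choose (t - i) then 0 else (m.choose i - if i = 0 then 0 else m.choose (i - 1))
         else
           ∑ i ∈ Finset.range (m - (t + c) + 1),
             if 0 ∣ (m - t - i).choose (m - (t + c) - i) then 0 else (m.choose i - if i = 0 then 0 else m.choose (i - 1)))
      else 0) := by
  split_ifs
  · exact le_rfl
  · exact wilson_sum_prime_le_zero p m t (t + c)
  · exact wilson_sum_prime_le_zero p m (m - (t + c)) (m - t)
  · exact le_rfl

/-- (B=) THE BLOCK CRITERION: for a prime `p > c > 0`, a feasible block keeps its characteristic-`0` value in characteristic `p` iff it is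
empty (`m < t + c`) or `min (t, m − t − c) + c < p` (Kummer: no carry in any `C(u + c, u)`, `u ≤ min (t, m − t − c)`). -/
theorem blockval_eq_iff {p c : ℕ} (hp : p.Prime) (hc : 0 < c) (hcp : c < p) (m t : ℕ) (P : Prop) [Decidable P] :
    (if P then
        (if m < t + c then 0
         else if t + (t + c) ≤ m then
           ∑ i ∈ Finset.range (t + 1),
             if p ∣ (t + c - i).choose (t - i) then 0 else (m.choose i - if i = 0 then 0 else m.choose (i - 1))
         else
           ∑ i ∈ Finset.range (m - (t + c) + 1),
             if p ∣ (m - t - i).choose (m - (t + c) - i) then 0 else (m.choose i - if i = 0 then 0 else m.choose (i - 1)))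
      else 0) =
      (if P then
        (if m < t + c then 0
         else if t + (t + c) ≤ m then
           ∑ i ∈ Finset.range (t + 1),
             if 0 ∣ (t + c - i).choose (t - i) then 0 else (m.choose i - if i = 0 then 0 else m.choose (i - 1))
         else
           ∑ i ∈ Finset.range (m - (t + c) + 1),
             if 0 ∣ (m - t - i).choose (m - (t + c) - i) then 0 else (m.choose i - if i = 0 then 0 else m.choose (i - 1)))
      else 0) ↔ (P → m < t + c ∨ min t (m - t - c) + c < p) := by
  by_cases hP : P
  · rw [if_pos hP, if_pos hP]
    by_cases h1 : m < t + c
    · rw [if_pos h1, if_pos h1]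
      exact iff_of_true rfl (fun _ => Or.inl h1)
    · rw [if_neg h1, if_neg h1]
      by_cases h2 : t + (t + c) ≤ m
      · rw [if_pos h2, if_pos h2, wilson_sum_prime_eq_zero_iff hp hc hcp m t (t + c) rfl (by omega),
          Nat.min_eq_left (by omega)]
        constructor
        · exact fun h _ => Or.inr h
        · intro h
          rcases h hP with h | h
          · exact absurd h h1
          · exact h
      · rw [if_neg h2, if_neg h2, wilson_sum_prime_eq_zero_iff hp hc hcp m (m - (t + c)) (m - t) (by omega) (by omega),
          Nat.min_eq_right (by omega)]
        constructor
        · intro h _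
          right
          omega
        · intro h
          rcases h hP with h | h
          · exact absurd h h1
          · omega
  · rw [if_neg hP, if_neg hP]
    exact iff_of_true rfl (fun h => absurd h hP)

/-! ## §4 THE CRITERION for the census matrix of `×q^c` -/

/-- **(CRIT) WHEN DOES CHARACTERISTIC `p` SEE THEOREM L'S RANK?** For a prime `p > c ≥ 1`, a field `K` of characteristic `p` and a field `K₀` of
characteristic `0`: anchor 229's multiplicity matrix of `×q^c` at `(k, e, j)` (VERBATIM) has the same rank over `K` as over `K₀` (THEOREM L's value)
iff EVERY feasible label `μ` (`e+1 ∣ j + Σμ`, `(e+1)s ≤ j + Σμ`; `s = #{μ ≠ 0}`, `t = (j + Σμ)/(e+1) − s`, `m = k − s`) has an empty block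
(`m < t + c`) or satisfies `min (t, m − t − c) + c < p`. -/
theorem rank_charP_eq_rank_charZero_iff (K K₀ : Type*) [Field K] [Field K₀] (p : ℕ) [CharP K p] [CharZero K₀] (hp : p.Prime)
    (k e c j : ℕ) (hc : 0 < c) (hcp : c < p) :
    (Matrix.of fun (v : {v : Fin k → Fin (e + 2) // (∑ i, (v i : ℕ)) + j = k * (e + 1)})
        (m : {m : Fin k → Fin (e + 2) // (∑ i, (m i : ℕ)) + (j + c * (e + 1)) = k * (e + 1)}) =>
      ((((List.flatMap (colR (e + 3)))^[c] [List.ofFn (fun i => (m.1 i : ℕ))]).count (List.ofFn (fun i => (v.1 i : ℕ))) : ℕ) : K)).rank =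
    (Matrix.of fun (v : {v : Fin k → Fin (e + 2) // (∑ i, (v i : ℕ)) + j = k * (e + 1)})
        (m : {m : Fin k → Fin (e + 2) // (∑ i, (m i : ℕ)) + (j + c * (e + 1)) = k * (e + 1)}) =>
      ((((List.flatMap (colR (e + 3)))^[c] [List.ofFn (fun i => (m.1 i : ℕ))]).count (List.ofFn (fun i => (v.1 i : ℕ))) : ℕ) : K₀)).rank ↔
    ∀ μ : Fin k → Fin (e + 1),
      (e + 1) ∣ (j + ∑ i, (μ i : ℕ)) ∧ (e + 1) * (Finset.univ.filter (fun l => (μ l : ℕ) ≠ 0)).card ≤ j + ∑ i, (μ i : ℕ) →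
        k - (Finset.univ.filter (fun l => (μ l : ℕ) ≠ 0)).card <
            ((j + ∑ i, (μ i : ℕ)) / (e + 1) - (Finset.univ.filter (fun l => (μ l : ℕ) ≠ 0)).card) + c ∨
          min ((j + ∑ i, (μ i : ℕ)) / (e + 1) - (Finset.univ.filter (fun l => (μ l : ℕ) ≠ 0)).card)
              (k - (Finset.univ.filter (fun l => (μ l : ℕ) ≠ 0)).card -
                ((j + ∑ i, (μ i : ℕ)) / (e + 1) - (Finset.univ.filter (fun l => (μ l : ℕ) ≠ 0)).card) - c) + c < p := by
  rw [rank_mulDeltaPow_levels_eq_sum_wilson K p k e c j (cast_factorial_ne_zero K p hp c hcp),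
    rank_mulDeltaPow_levels_eq_sum_wilson K₀ 0 k e c j (by exact_mod_cast Nat.factorial_ne_zero c),
    Finset.sum_eq_sum_iff_of_le (fun μ _ => blockval_le p _ _ c _)]
  simp only [Finset.mem_univ, forall_true_left]
  exact forall_congr' (fun μ => blockval_eq_iff hp hc hcp _ _ _)

/-- **(CRIT′) NO EXCEPTIONS FOR `2p > k + c`**: since `min (t, m − t − c) + c ≤ (m + c)/2 ≤ (k + c)/2`, every prime with `2p > k + c`
(in particular every `p > k`, PROBE 12) sees THEOREM L's rank for `×q^c`, `1 ≤ c < p`. -/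
theorem rank_charP_eq_rank_charZero_of_lt (K K₀ : Type*) [Field K] [Field K₀] (p : ℕ) [CharP K p] [CharZero K₀] (hp : p.Prime)
    (k e c j : ℕ) (hc : 0 < c) (hcp : c < p) (hk : k + c < 2 * p) :
    (Matrix.of fun (v : {v : Fin k → Fin (e + 2) // (∑ i, (v i : ℕ)) + j = k * (e + 1)})
        (m : {m : Fin k → Fin (e + 2) // (∑ i, (m i : ℕ)) + (j + c * (e + 1)) = k * (e + 1)}) =>
      ((((List.flatMap (colR (e + 3)))^[c] [List.ofFn (fun i => (m.1 i : ℕ))]).count (List.ofFn (fun i => (v.1 i : ℕ))) : ℕ) : K)).rank =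
    (Matrix.of fun (v : {v : Fin k → Fin (e + 2) // (∑ i, (v i : ℕ)) + j = k * (e + 1)})
        (m : {m : Fin k → Fin (e + 2) // (∑ i, (m i : ℕ)) + (j + c * (e + 1)) = k * (e + 1)}) =>
      ((((List.flatMap (colR (e + 3)))^[c] [List.ofFn (fun i => (m.1 i : ℕ))]).count (List.ofFn (fun i => (v.1 i : ℕ))) : ℕ) : K₀)).rank := by
  rw [rank_charP_eq_rank_charZero_iff K K₀ p hp k e c j hc hcp]
  intro μ _
  by_cases h : k - (Finset.univ.filter (fun l => (μ l : ℕ) ≠ 0)).card <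
      ((j + ∑ i, (μ i : ℕ)) / (e + 1) - (Finset.univ.filter (fun l => (μ l : ℕ) ≠ 0)).card) + c
  · exact Or.inl h
  · right
    have hs : (Finset.univ.filter (fun l => (μ l : ℕ) ≠ 0)).card ≤ k :=
      (Finset.card_filter_le _ _).trans_eq (by rw [Finset.card_univ, Fintype.card_fin])
    rw [Nat.min_def]
    split_ifs <;> omega

/-! ## §5 SHARPNESS of the corollary `k + c < 2p`: the exceptional primes `p > c` of `×q^c` on `k` variables are exactly those with `2p ≤ k + c` -/

/-- (≤) in every characteristic `p > c` the rank is at most THEOREM L's value (terms of 16b's double sum are only dropped). -/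
theorem rank_charP_le_rank_charZero (K K₀ : Type*) [Field K] [Field K₀] (p : ℕ) [CharP K p] [CharZero K₀] (hp : p.Prime)
    (k e c j : ℕ) (hcp : c < p) :
    (Matrix.of fun (v : {v : Fin k → Fin (e + 2) // (∑ i, (v i : ℕ)) + j = k * (e + 1)})
        (m : {m : Fin k → Fin (e + 2) // (∑ i, (m i : ℕ)) + (j + c * (e + 1)) = k * (e + 1)}) =>
      ((((List.flatMap (colR (e + 3)))^[c] [List.ofFn (fun i => (m.1 i : ℕ))]).count (List.ofFn (fun i => (v.1 i : ℕ))) : ℕ) : K)).rank ≤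
    (Matrix.of fun (v : {v : Fin k → Fin (e + 2) // (∑ i, (v i : ℕ)) + j = k * (e + 1)})
        (m : {m : Fin k → Fin (e + 2) // (∑ i, (m i : ℕ)) + (j + c * (e + 1)) = k * (e + 1)}) =>
      ((((List.flatMap (colR (e + 3)))^[c] [List.ofFn (fun i => (m.1 i : ℕ))]).count (List.ofFn (fun i => (v.1 i : ℕ))) : ℕ) : K₀)).rank := by
  rw [rank_mulDeltaPow_levels_eq_sum_wilson K p k e c j (cast_factorial_ne_zero K p hp c hcp),
    rank_mulDeltaPow_levels_eq_sum_wilson K₀ 0 k e c j (by exact_mod_cast Nat.factorial_ne_zero c)]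
  exact Finset.sum_le_sum (fun μ _ => blockval_le p _ _ c _)

/-- **(SHARP) THE COROLLARY `k + c < 2p` IS SHARP**: for a prime `p` with `1 ≤ c < p` and `2p ≤ k + c`, the rank of anchor 229's multiplicity matrix of
`×q^c` DROPS in characteristic `p` at the level `j = (e+1)(p − c)` (witness: the zero label `μ = 0`, `s = 0`, `t = p − c`, block `c!·W_{p−c, p}` on all `k`
coordinates, `min (p − c, k − p) + c = p`). Hence the primes `p > c` at which `×q^c` on `k` variables is exceptional at SOME level are exactly those
with `2p ≤ k + c`, in every truncation degree `e`. -/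
theorem rank_charP_lt_rank_charZero (K K₀ : Type*) [Field K] [Field K₀] (p : ℕ) [CharP K p] [CharZero K₀] (hp : p.Prime)
    (k e c : ℕ) (hc : 0 < c) (hcp : c < p) (hk : 2 * p ≤ k + c) :
    (Matrix.of fun (v : {v : Fin k → Fin (e + 2) // (∑ i, (v i : ℕ)) + (e + 1) * (p - c) = k * (e + 1)})
        (m : {m : Fin k → Fin (e + 2) // (∑ i, (m i : ℕ)) + ((e + 1) * (p - c) + c * (e + 1)) = k * (e + 1)}) =>
      ((((List.flatMap (colR (e + 3)))^[c] [List.ofFn (fun i => (m.1 i : ℕ))]).count (List.ofFn (fun i => (v.1 i : ℕ))) : ℕ) : K)).rank <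
    (Matrix.of fun (v : {v : Fin k → Fin (e + 2) // (∑ i, (v i : ℕ)) + (e + 1) * (p - c) = k * (e + 1)})
        (m : {m : Fin k → Fin (e + 2) // (∑ i, (m i : ℕ)) + ((e + 1) * (p - c) + c * (e + 1)) = k * (e + 1)}) =>
      ((((List.flatMap (colR (e + 3)))^[c] [List.ofFn (fun i => (m.1 i : ℕ))]).count (List.ofFn (fun i => (v.1 i : ℕ))) : ℕ) : K₀)).rank := by
  refine lt_of_le_of_ne (rank_charP_le_rank_charZero K K₀ p hp k e c _ hcp) (fun heq => ?_)
  have h := (rank_charP_eq_rank_charZero_iff K K₀ p hp k e c ((e + 1) * (p - c)) hc hcp).mp heq (fun _ => 0)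
  have hs : (Finset.univ.filter (fun l : Fin k => (((fun _ => (0 : Fin (e + 1))) l : Fin (e + 1)) : ℕ) ≠ 0)).card = 0 := by
    simp
  have hsum : (∑ i : Fin k, (((fun _ => (0 : Fin (e + 1))) i : Fin (e + 1)) : ℕ)) = 0 := by simp
  rw [hs, hsum, add_zero, mul_zero] at h
  have ht : (e + 1) * (p - c) / (e + 1) = p - c := Nat.mul_div_cancel_left _ (Nat.succ_pos e)
  rw [ht] at h
  have h' := h ⟨Dvd.intro _ rfl, Nat.zero_le _⟩
  rw [Nat.min_def] at h'
  split_ifs at h' <;> omega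

/-! ## §6 THE EXCEPTIONAL PRIMES ABOVE `c`, all levels at once -/

/-- **THE EXCEPTIONAL PRIMES OF `×q^c`** (`1 ≤ c < p` prime, any truncation degree `e`): the rank of anchor 229's multiplicity matrix of `×q^c` on `k`
variables drops in characteristic `p` at SOME level `j` if and only if `2p ≤ k + c` (§4's corollary and §5's sharpness combined; for `p ≤ c` the
characteristic-`p` rank is `0`, anchor 230). -/
theorem exists_rank_charP_lt_iff (K K₀ : Type*) [Field K] [Field K₀] (p : ℕ) [CharP K p] [CharZero K₀] (hp : p.Prime)
    (k e c : ℕ) (hc : 0 < c) (hcp : c < p) :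
    (∃ j : ℕ, (Matrix.of fun (v : {v : Fin k → Fin (e + 2) // (∑ i, (v i : ℕ)) + j = k * (e + 1)})
        (m : {m : Fin k → Fin (e + 2) // (∑ i, (m i : ℕ)) + (j + c * (e + 1)) = k * (e + 1)}) =>
      ((((List.flatMap (colR (e + 3)))^[c] [List.ofFn (fun i => (m.1 i : ℕ))]).count (List.ofFn (fun i => (v.1 i : ℕ))) : ℕ) : K)).rank <
    (Matrix.of fun (v : {v : Fin k → Fin (e + 2) // (∑ i, (v i : ℕ)) + j = k * (e + 1)})
        (m : {m : Fin k → Fin (e + 2) // (∑ i, (m i : ℕ)) + (j + c * (e + 1)) = k * (e + 1)}) =>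
      ((((List.flatMap (colR (e + 3)))^[c] [List.ofFn (fun i => (m.1 i : ℕ))]).count (List.ofFn (fun i => (v.1 i : ℕ))) : ℕ) : K₀)).rank) ↔
    2 * p ≤ k + c := by
  constructor
  · rintro ⟨j, hj⟩
    by_contra hk
    exact (ne_of_lt hj) (rank_charP_eq_rank_charZero_of_lt K K₀ p hp k e c j hc hcp (by omega))
  · intro hk
    exact ⟨(e + 1) * (p - c), rank_charP_lt_rank_charZero K K₀ p hp k e c hc hcp hk⟩

end Summit.HodgeConjecture.HodgeConjecture.HodgeLocus.Census.UnitColumnRankLevelsCriterion
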